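import Summits.QuantumFields.YangMills.Theorems.BalabanUVNodesN21GappedPairRoadK3V6Knit
import Summits.QuantumFields.YangMills.Theorems.BalabanUVNodesN21GappedTopPairReading13CoPHSignFree
import Summits.QuantumFields.YangMills.Theorems.BalabanUVNodesN21GappedPairRoadRStepNeutral
import Summits.QuantumFields.YangMills.Theorems.BalabanUVNodesN21GappedTopCutDials
import Summits.QuantumFields.YangMills.Theorems.BalabanUVNodesN20GappedRoadCutZeroKnit
import Summits.QuantumFields.YangMills.Theorems.BalabanUVNodesN20KeyedRelWeightAnyCarriers

/-!
# N21 (NE7c) · K3⁸ ON THE PAIR ROAD AT PLAIN DIALS (SIGN-FREE) AND WITH BOTH DIAL PAIRS PRODUCED FROM TWO CLOSENESS LETTERS — the consumer's END-TO-END of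
# dag-n21-d's `spineGivenEndpointR13SepCoPHV_of_gap2Road` on dag-n21-w7's SIGN-FREE pair faces: no «sign OR width zero» rows; the dials `(ρ, n₁)`, `(ρ′, n₂)` ∃-produced from
# ONE relative closeness letter per indicator family (`δc` for (3.2) in units of `ε`, `δc″` for (3.3) in units of `2δ_k`); N19′ ∕ N20 asked ∀ compatible dials; N20 also read
# dial-free at the record weights (dag-n21-d V5b)

Track A of `YM-PLAN.md` (cell `pub-ymgap`), node **N21** (NE7c, NOT PRINTED); WIDTH SEAT `pub-ymgap-dag-n21-w2` (gen 4), file 14.  THEOREMS ONLY: 0 `def`, 0 `sorry`;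
COUNT-NEUTRAL; `--kind proof --supports stmt-QuantumFields-27366 --as helper` (K3⁸).  Imports BY NAME: dag-n21-d g12's V3 `…N21GappedPairRoadK3V6Knit` (p642482:
`keyedExtraction_of_gap2Pin`, `keyedRelWeight_of_gap2Pin_of_witness`; through it V1 `…N21GappedRoadK3V6Knit` p629674: the reading-generic `…_of_livePin` family,
`exists_reading_livePin`) and V5b `…N21GappedPairRoadRStepNeutral` (p635796: `relWeightBound_gap2Carriers_iff_record`); dag-n21-w7 g3's FILE 17
`…N21GappedTopPairReading13CoPHSignFree` (p642258: `shellWeightBound_crGap2₁₃VAt_signFree`, `shellWeightBound_carriersGap2₁₃_signFree`); this seat's g3 file 2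
`…N21GappedTopCutDials` (p623041: `exists_widthDepthLetters_of_summable`); dag-n20-w2's `…N20KeyedRelWeightAnyCarriers` (p633479: `relWeightBound_classSet₁₃_cutZero`,
any carriers) and `…N20GappedRoadCutZeroKnit` (p635103: `core_badClass₁₃_cutZero_of_allClasses`).  No new Theses import (V1 concludes the route decl BY NAME); restates
nothing.

WHY.  V3 knits K3⁸ on dag-n21-w7's PAIR reading `crGap2₁₃V` under V6's satisfiable rows «`0 ≤ ε` at both tops OR `ρ_K = 0`», «`0 ≤ δ` at both old levels OR `ρ′_K = 0`» — fine
for FREE dials, but a consumer whose dials are PRODUCED from closeness letters (`2δc ≤ ρ`, …) cannot honour «`ρ_K = 0` where a sign fails».  dag-n21-w7's FILE 17 proved the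
same faces with NOTHING about the signs (`…_signFree`: at a non-positive letter the indicator tests collapse, the grids need no monotonicity).  §1–§2 of THIS FILE are V3's §4–§5
RE-KEYED on the sign-free faces (proof bodies dag-n21-d's, cited — two face invocations swapped, four rows deleted); §3 is the pair twin of this seat's file 13
`…N21GappedRoadK3V6KnitOfCloseness`: TWO closeness letters in, K3⁸ out, N19′ ∕ N20 asked for witnesses at the doubly-gapped cores ∕ carriers for EVERY local dial quadruple
`(ρ, n₁; ρ′, n₂)` compatible with `(δc, δc″)` (the rows of this seat's pair junction, files 7∕8∕10∕12), and the RECORD edition reading N20 dial-free at dag-n20-d's `weightA∕B₁₃`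
through V5b (+ the persistence-policy row).

WHAT IS PROVED (kernel; [bookkeeping] throughout — pure logic over the named theorems; NO estimate).
§1 (pair pin, sign-free) `keyedShellWeight_of_gap2Pin_signFree` · `keyedCoreEdgeHolderD4V_of_gap2Pin_of_witness_signFree` · ★★ `spineGivenEndpointR13SepCoPHV_of_gap2Pin_signFree`.
§2 (pair road, sign-free, free dials) ★★★ `spineGivenEndpointR13SepCoPHV_of_gap2Road_signFree`.
§3 (two closeness letters) ★★★ `spineGivenEndpointR13SepCoPHV_of_gap2Road_of_closeness` · ★★★ `spineGivenEndpointR13SepCoPHV_of_gap2Road_of_closeness_record` · ★★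
   `exists_gap2Pinned_faces_of_closeness`.
§4 (two closeness letters at the ZERO CUT, sign-free) ★★★ `spineGivenEndpointR13SepCoPHV_of_gap2Road_of_closeness_cutZero` — the pair road's FEWEST-BINDER edition: (H-ζ) + δc + δc″ +
   K4 + N19′'s all-classes NE7 sandwich between the two runs' DOUBLY-GAPPED cores (∀ compatible dials, under the prefix) + node U5's Target; N20's line is dag-n20-w2's
   any-carriers zero-cut theorem (`W := 0`), N21 ∕ N27x by §1.

HONEST FRAMING (binding).  Bookkeeping BY NAME; NO estimate of Bałaban's asserted or used; both closeness letters (N16's two-run closeness of the (2.17) resp. (3.3) statistics at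
the indicators' scales, NOT PRINTED), K4, N20's and N19′'s witnesses, node U5's Target and (H-ζ) are DISPLAYED HYPOTHESES inhabited for no family today (K0⁷ OPEN); NE7 ∕ NE7b ∕
NE7c NOT PRINTED for `d = 4`; NE7c at print's FIXED thresholds NOT proved (the discharged N21 face is dag-n21-w7's (M1)-free one at SELECTED relative letters of the two
top-step indicator families; ζ ∕ (3.5) and the levels below the top stay located); this is NOT `stub_expansion13HV` (its pin names `crOfRecord₁₃V`, untouched); **N21 NOT
discharged**; K3⁸ NOT claimed (v6 0∕2); counts UNMOVED (typed 28∕28 · discharged 5∕27); never a count claim.  No `sorry`, no `def`, no `instance`, no `notation`; standard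
axioms.  One finite four-torus programme at fixed `ε` — NOT ℝ⁴, NOT OS, NOT a mass gap, NOT the Clay problem.  No decl below carries a cite tag.
-/

set_option autoImplicit false

noncomputable section

open scoped BigOperators

namespace Summit.QuantumFields.YangMills.Theorems.N21GappedPairRoadK3V6KnitOfCloseness

open Literature.MathematicalPhysics.QuantumFieldTheory.Balaban1983to89
open Literature.MathematicalPhysics.QuantumFieldTheory.Balaban1983to89.T4Continuum
open Literature.MathematicalPhysics.QuantumFieldTheory.Balaban1983to89.Node00
open T4WeightBudget (RelWeightBound)
open T4ContinuumYM4Torus (ForSmallCouplings)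
open Summit.QuantumFields.BalabanUV.T4Continuum.Spine
open YMDAG.UVSplit (classSet₁₃ badClass₁₃ weightA₁₃ weightB₁₃)
open Summit.QuantumFields.YangMills.BalabanUVNodes.SpineCanonicalWeights (core_nonneg_of_shellWeightBound)
open Summit.QuantumFields.YangMills.Theorems.K3V5Defs (SpineReading RateReadingFn CutReading KeyedRelWeight KeyedShellWeight LiveSel PHolderD4)
open Summit.QuantumFields.YangMills.Theorems.K3V6Defs (KeyedRatesHolderD4V KeyedCoreEdgeHolderD4V KeyedExtractionV spineGivenEndpointR13SepCoPHV_of_facesV)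
open Summit.QuantumFields.YangMills.BalabanUVNodes.N20OffLiveOneTermReading (crOneTerm₁₃)
open Summit.QuantumFields.YangMills.Theorems.N21ShellSplitOfRecord13CoPH (WidthLetter₁₃CoPH DepthLetter₁₃CoPH relWeightBound_gap2Carriers_iff_record)
open Summit.QuantumFields.YangMills.Theorems.N21GappedTopPair13CoPH (crGap2₁₃V gapWeight2A₁₃ gapWeight2B₁₃ gapShell2A₁₃ gapShell2B₁₃ gapCore2A₁₃ gapCore2B₁₃ core_crGap2₁₃VAt
  gapWeight2A₁₃_sub_gapShell2A₁₃ gapWeight2B₁₃_sub_gapShell2B₁₃ shellWeightBound_crGap2₁₃VAt_signFree shellWeightBound_carriersGap2₁₃_signFree)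
open Summit.QuantumFields.YangMills.Theorems.N21GappedTopCutDials (exists_widthDepthLetters_of_summable)
open Summit.QuantumFields.YangMills.BalabanUVNodes.N20KeyedRelWeightAnyCarriers (relWeightBound_classSet₁₃_cutZero)
open Summit.QuantumFields.YangMills.BalabanUVNodes.N20GappedRoadCutZeroKnit (core_badClass₁₃_cutZero_of_allClasses)
open Summit.QuantumFields.YangMills.Theorems.N21GappedRoadK3V6Knit (exists_reading_livePin keyedShellWeight_of_livePin keyedCoreEdgeHolderD4V_of_livePin
  keyedExtraction_of_gap2Pin keyedRelWeight_of_gap2Pin_of_witness)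

/-! ## §1 The pair pin at PLAIN dials: N21 and N19′-from-witness faces on dag-n21-w7's SIGN-FREE faces -/

section Gap2PinSF

variable (jc : CutReading) (ρ ρ' : WidthLetter₁₃CoPH 2) (n₁ n₂ : DepthLetter₁₃CoPH 2) {cr : SpineReading}
  (hon : ∀ (F : T4Family) (θ : Stage13HParams F 2) (hP : θ.Provisos₁₃CoPH F 2) (g₀ : ℕ → ℝ) (os : List (ULoop F)),
    LiveSel F θ → cr F θ hP g₀ os = crGap2₁₃V 2 (jc F θ hP g₀ os) ρ ρ' n₁ n₂ F θ hP g₀ os)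
  (hoff : ∀ (F : T4Family) (θ : Stage13HParams F 2) (hP : θ.Provisos₁₃CoPH F 2) (g₀ : ℕ → ℝ) (os : List (ULoop F)), ¬ LiveSel F θ → cr F θ hP g₀ os = crOneTerm₁₃ 0 F θ hP g₀ os)
  (hζm : ∀ (F : T4Family) (θ : Stage13HParams F 2), θ.Provisos₁₃CoPH F 2 → ((θ.ZhUnity F 2 ∧ θ.SlotsNondegenerate₁₃ F 2) ∧ LiveSel F θ) → θ.Admissible F 2 →
    ZetaMeasurable F 2 θ.ζ)
include hon hoff hζm

/-- ★★ **N21's v6 FACE ON THE PAIR-PINNED READING, SIGN-FREE** — `KeyedShellWeight cr` for `cr` pinned to `crGap2₁₃V 2 (jc …) ρ ρ′ n₁ n₂` on the live line and to `crOneTerm₁₃ 0`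
off it, from dag-n21-w7's `shellWeightBound_crGap2₁₃VAt_signFree` (rows: (H-ζ) on the live line; `0 ≤ ρ_K, ρ′_K ≤ 1`; `Σ_K (1∕(n₁ K+1) + 1∕(n₂ K+1)) < ∞` — nothing about the
signs of `ε`, `δ`).  V3's `keyedShellWeight_of_gap2Pin` with the two «sign OR width zero» rows deleted. [bookkeeping] -/
theorem keyedShellWeight_of_gap2Pin_signFree
    (hρ : ∀ (F : T4Family) (θ : Stage13HParams F 2) (hP : θ.Provisos₁₃CoPH F 2) (g₀ : ℕ → ℝ) (os : List (ULoop F)) (K : ℕ),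
      (0 ≤ ρ F θ hP g₀ os K ∧ ρ F θ hP g₀ os K ≤ 1) ∧ (0 ≤ ρ' F θ hP g₀ os K ∧ ρ' F θ hP g₀ os K ≤ 1))
    (hn : ∀ (F : T4Family) (θ : Stage13HParams F 2) (hP : θ.Provisos₁₃CoPH F 2) (g₀ : ℕ → ℝ) (os : List (ULoop F)),
      Summable (fun K => 1 / ((n₁ F θ hP g₀ os K : ℝ) + 1) + 1 / ((n₂ F θ hP g₀ os K : ℝ) + 1))) :
    KeyedShellWeight cr :=
  keyedShellWeight_of_livePin hon hoff fun F θ hP hG hθ g₀ os =>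
    shellWeightBound_crGap2₁₃VAt_signFree 0 (jc F θ hP g₀ os) ρ ρ' n₁ n₂ θ hP g₀ os (EOfRecord₁₃ F 2 θ.toStage13Params) hG.2 (hζm F θ hP hG hθ)
      (fun K => (hρ F θ hP g₀ os K).1.1) (fun K => (hρ F θ hP g₀ os K).1.2) (fun K => (hρ F θ hP g₀ os K).2.1) (fun K => (hρ F θ hP g₀ os K).2.2)
      (hn F θ hP g₀ os)

/-- **N19′'s slot-keyed face on the pair-pinned reading FROM A WITNESS at the doubly-gapped cores** on the live line AND node U5's Target off it — SIGN-FREE (core non-negativity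
from dag-n21-w7's sign-free carriers face).  V3's `keyedCoreEdgeHolderD4V_of_gap2Pin_of_witness` with the two sign rows deleted (proof body dag-n21-d's, cited).  Both binders
HYPOTHESES; NE7 NOT PRINTED for `d = 4`. [bookkeeping] -/
theorem keyedCoreEdgeHolderD4V_of_gap2Pin_of_witness_signFree (β : ℝ) (rr : RateReadingFn)
    (hρ : ∀ (F : T4Family) (θ : Stage13HParams F 2) (hP : θ.Provisos₁₃CoPH F 2) (g₀ : ℕ → ℝ) (os : List (ULoop F)) (K : ℕ),
      (0 ≤ ρ F θ hP g₀ os K ∧ ρ F θ hP g₀ os K ≤ 1) ∧ (0 ≤ ρ' F θ hP g₀ os K ∧ ρ' F θ hP g₀ os K ≤ 1))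
    (hn : ∀ (F : T4Family) (θ : Stage13HParams F 2) (hP : θ.Provisos₁₃CoPH F 2) (g₀ : ℕ → ℝ) (os : List (ULoop F)),
      Summable (fun K => 1 / ((n₁ F θ hP g₀ os K : ℝ) + 1) + 1 / ((n₂ F θ hP g₀ os K : ℝ) + 1)))
    (h19on : ∀ (F : T4Family) (θ : Stage13HParams F 2) (h : θ.Provisos₁₃SepCoPH F 2) (v : Revision₁₃ F 2 θ h),
      ((θ.ZhUnity F 2 ∧ θ.SlotsNondegenerate₁₃ F 2) ∧ LiveSel F θ) → θ.Admissible F 2 →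
      B16.EndStatementBPrinted (datumOfRecord₁₃SepCoPHV F 2 θ h v).C → DagBinding.EndpointExistence (datumOfRecord₁₃SepCoPHV F 2 θ h v).C.toB12 →
        ForSmallCouplings (datumOfRecord₁₃SepCoPHV F 2 θ h v) fun g₀ => ∀ os : List (ULoop F),
          PHolderD4 β (datumOfRecord₁₃SepCoPHV F 2 θ h v) (rr F θ h.toCore g₀ os) →
            letI : DecidableEq (Σ K, SiteSeqKey F (0 + K)) := Classical.decEq _
            ∃ δ : ℕ → ℝ, NE7.Core 1 (F.side ^ 4) (classSet₁₃ θ 0 g₀) (badClass₁₃ θ 0 g₀ (jc F θ h.toCore g₀ os))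
              (gapCore2A₁₃ θ h.toCore 0 g₀ os (ρ F θ h.toCore g₀ os) (ρ' F θ h.toCore g₀ os) (n₁ F θ h.toCore g₀ os) (n₂ F θ h.toCore g₀ os))
              (gapCore2B₁₃ θ h.toCore 0 g₀ os (ρ F θ h.toCore g₀ os) (ρ' F θ h.toCore g₀ os) (n₁ F θ h.toCore g₀ os) (n₂ F θ h.toCore g₀ os)) δ ∧ Summable δ)
    (h19off : ∀ (F : T4Family) (θ : Stage13HParams F 2) (hP : θ.Provisos₁₃CoPH F 2), ((θ.ZhUnity F 2 ∧ θ.SlotsNondegenerate₁₃ F 2) ∧ ¬ LiveSel F θ) → θ.Admissible F 2 →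
      ∀ (g₀ : ℕ → ℝ) (os : List (ULoop F)), PHolderD4 β (datumOfRecord₁₃CoPH F 2 θ hP) (rr F θ hP g₀ os) →
        ∃ δ : ℕ → ℝ, NE7.Target ((F.side : ℝ) ^ 4) 1 δ (fun K => T4GenFunBounds.schemeZ ((datumOfRecord₁₃CoPH F 2 θ hP).scheme g₀) os (0 + K))) :
    KeyedCoreEdgeHolderD4V β cr rr := by
  -- adapted from dag-n21-d's V3 `keyedCoreEdgeHolderD4V_of_gap2Pin_of_witness` (p642482): the carriers face is dag-n21-w7's sign-free one
  refine keyedCoreEdgeHolderD4V_of_livePin hon hoff β rr (fun F θ h v hG hθ hB hE => ?_) h19off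
  refine ForSmallCouplings.mono (fun g₀ h' os hPr => ?_) (h19on F θ h v hG hθ hB hE)
  obtain ⟨δ, hδ', hsum⟩ := h' os hPr
  have hA : (fun K t x => gapWeight2A₁₃ θ h.toCore 0 g₀ os (ρ F θ h.toCore g₀ os) (ρ' F θ h.toCore g₀ os) (n₁ F θ h.toCore g₀ os) (n₂ F θ h.toCore g₀ os) K t x -
      gapShell2A₁₃ θ h.toCore 0 g₀ os (ρ F θ h.toCore g₀ os) (ρ' F θ h.toCore g₀ os) (n₁ F θ h.toCore g₀ os) (n₂ F θ h.toCore g₀ os) K t x) =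
      gapCore2A₁₃ θ h.toCore 0 g₀ os (ρ F θ h.toCore g₀ os) (ρ' F θ h.toCore g₀ os) (n₁ F θ h.toCore g₀ os) (n₂ F θ h.toCore g₀ os) :=
    funext fun K => funext fun t => funext fun x => gapWeight2A₁₃_sub_gapShell2A₁₃ θ h.toCore 0 g₀ os _ _ _ _ K t x
  have hB' : (fun K t x => gapWeight2B₁₃ θ h.toCore 0 g₀ os (ρ F θ h.toCore g₀ os) (ρ' F θ h.toCore g₀ os) (n₁ F θ h.toCore g₀ os) (n₂ F θ h.toCore g₀ os) K t x -
      gapShell2B₁₃ θ h.toCore 0 g₀ os (ρ F θ h.toCore g₀ os) (ρ' F θ h.toCore g₀ os) (n₁ F θ h.toCore g₀ os) (n₂ F θ h.toCore g₀ os) K t x) =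
      gapCore2B₁₃ θ h.toCore 0 g₀ os (ρ F θ h.toCore g₀ os) (ρ' F θ h.toCore g₀ os) (n₁ F θ h.toCore g₀ os) (n₂ F θ h.toCore g₀ os) :=
    funext fun K => funext fun t => funext fun x => gapWeight2B₁₃_sub_gapShell2B₁₃ θ h.toCore 0 g₀ os _ _ _ _ K t x
  have hsh := shellWeightBound_carriersGap2₁₃_signFree 0 θ h.toCore g₀ os (EOfRecord₁₃ F 2 θ.toStage13Params) hG.2 (hζm F θ h.toCore hG hθ)
    (fun K => (hρ F θ h.toCore g₀ os K).1.1) (fun K => (hρ F θ h.toCore g₀ os K).1.2) (fun K => (hρ F θ h.toCore g₀ os K).2.1) (fun K => (hρ F θ h.toCore g₀ os K).2.2)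
    (hn F θ h.toCore g₀ os)
  letI : DecidableEq (Σ K, SiteSeqKey F (0 + K)) := Classical.decEq _
  have hP0 := core_nonneg_of_shellWeightBound (Bad := badClass₁₃ θ 0 g₀ (jc F θ h.toCore g₀ os)) hsh
  exact ⟨_, core_crGap2₁₃VAt 0 (jc F θ h.toCore g₀ os) ρ ρ' n₁ n₂ θ h.toCore g₀ os hP0 (by rw [hA, hB']; exact hδ') hsum⟩

/-- ★★ **K3⁸ ON THE PAIR ROAD AT THE PINNED READING, SIGN-FREE** — N21 and N27x DISCHARGED BY NAME (dag-n21-w7's sign-free face ∕ V3's extraction); K4, N20 `KeyedRelWeight cr`,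
N19′ `KeyedCoreEdgeHolderD4V β cr rr` HYPOTHESES at the pinned reading.  NOT `stub_expansion13HV`. [bookkeeping] -/
theorem spineGivenEndpointR13SepCoPHV_of_gap2Pin_signFree (β : ℝ) (rr : RateReadingFn)
    (hρ : ∀ (F : T4Family) (θ : Stage13HParams F 2) (hP : θ.Provisos₁₃CoPH F 2) (g₀ : ℕ → ℝ) (os : List (ULoop F)) (K : ℕ),
      (0 ≤ ρ F θ hP g₀ os K ∧ ρ F θ hP g₀ os K ≤ 1) ∧ (0 ≤ ρ' F θ hP g₀ os K ∧ ρ' F θ hP g₀ os K ≤ 1))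
    (hn : ∀ (F : T4Family) (θ : Stage13HParams F 2) (hP : θ.Provisos₁₃CoPH F 2) (g₀ : ℕ → ℝ) (os : List (ULoop F)),
      Summable (fun K => 1 / ((n₁ F θ hP g₀ os K : ℝ) + 1) + 1 / ((n₂ F θ hP g₀ os K : ℝ) + 1)))
    (h20 : KeyedRelWeight cr) (hr : KeyedRatesHolderD4V β rr) (h19 : KeyedCoreEdgeHolderD4V β cr rr) :
    Summit.QuantumFields.YangMills.Theses.BalabanUVNodes.SpineGivenEndpointR13SepCoPHV :=
  spineGivenEndpointR13SepCoPHV_of_facesV β cr rr h20 (keyedShellWeight_of_gap2Pin_signFree jc ρ ρ' n₁ n₂ hon hoff hζm hρ hn) hr h19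
    (keyedExtraction_of_gap2Pin jc ρ ρ' n₁ n₂ hon hoff hζm).2

end Gap2PinSF

/-! ## §2 The pair road at PLAIN dials, pin-free, SIGN-FREE -/

section Gap2RoadSF

/-- ★★★ **K3⁸ ON THE PAIR ROAD, PIN-FREE, SIGN-FREE** — V3's `spineGivenEndpointR13SepCoPHV_of_gap2Road` with the two «sign OR width zero» rows DELETED (dag-n21-w7's sign-free
faces).  Displayed: (H-ζ) on the live line, the dial rows `0 ≤ ρ_K, ρ′_K ≤ 1`, `Σ_K (1∕(n₁ K+1) + 1∕(n₂ K+1)) < ∞`, K4, N20's WITNESS at the doubly-gapped carriers on the live line,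
N19′'s WITNESS at the doubly-gapped cores on the live line (slot-keyed, under the prefix and `PHolderD4 β`), node U5's Target off the line — all HYPOTHESES. [bookkeeping] -/
theorem spineGivenEndpointR13SepCoPHV_of_gap2Road_signFree (β : ℝ) (rr : RateReadingFn) (jc : CutReading) (ρ ρ' : WidthLetter₁₃CoPH 2) (n₁ n₂ : DepthLetter₁₃CoPH 2)
    (hζm : ∀ (F : T4Family) (θ : Stage13HParams F 2), θ.Provisos₁₃CoPH F 2 → ((θ.ZhUnity F 2 ∧ θ.SlotsNondegenerate₁₃ F 2) ∧ LiveSel F θ) → θ.Admissible F 2 →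
      ZetaMeasurable F 2 θ.ζ)
    (hρ : ∀ (F : T4Family) (θ : Stage13HParams F 2) (hP : θ.Provisos₁₃CoPH F 2) (g₀ : ℕ → ℝ) (os : List (ULoop F)) (K : ℕ),
      (0 ≤ ρ F θ hP g₀ os K ∧ ρ F θ hP g₀ os K ≤ 1) ∧ (0 ≤ ρ' F θ hP g₀ os K ∧ ρ' F θ hP g₀ os K ≤ 1))
    (hn : ∀ (F : T4Family) (θ : Stage13HParams F 2) (hP : θ.Provisos₁₃CoPH F 2) (g₀ : ℕ → ℝ) (os : List (ULoop F)),
      Summable (fun K => 1 / ((n₁ F θ hP g₀ os K : ℝ) + 1) + 1 / ((n₂ F θ hP g₀ os K : ℝ) + 1)))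
    (hr : KeyedRatesHolderD4V β rr)
    (h20 : ∀ (F : T4Family) (θ : Stage13HParams F 2) (hP : θ.Provisos₁₃CoPH F 2), ((θ.ZhUnity F 2 ∧ θ.SlotsNondegenerate₁₃ F 2) ∧ LiveSel F θ) → θ.Admissible F 2 →
      ∀ (g₀ : ℕ → ℝ) (os : List (ULoop F)),
        ∃ W : ℕ → ℝ, RelWeightBound 1 (classSet₁₃ θ 0 g₀)
          (gapWeight2A₁₃ θ hP 0 g₀ os (ρ F θ hP g₀ os) (ρ' F θ hP g₀ os) (n₁ F θ hP g₀ os) (n₂ F θ hP g₀ os))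
          (gapWeight2B₁₃ θ hP 0 g₀ os (ρ F θ hP g₀ os) (ρ' F θ hP g₀ os) (n₁ F θ hP g₀ os) (n₂ F θ hP g₀ os)) (badClass₁₃ θ 0 g₀ (jc F θ hP g₀ os)) W)
    (h19 : ∀ (F : T4Family) (θ : Stage13HParams F 2) (h : θ.Provisos₁₃SepCoPH F 2) (v : Revision₁₃ F 2 θ h),
      ((θ.ZhUnity F 2 ∧ θ.SlotsNondegenerate₁₃ F 2) ∧ LiveSel F θ) → θ.Admissible F 2 →
      B16.EndStatementBPrinted (datumOfRecord₁₃SepCoPHV F 2 θ h v).C → DagBinding.EndpointExistence (datumOfRecord₁₃SepCoPHV F 2 θ h v).C.toB12 →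
        ForSmallCouplings (datumOfRecord₁₃SepCoPHV F 2 θ h v) fun g₀ => ∀ os : List (ULoop F),
          PHolderD4 β (datumOfRecord₁₃SepCoPHV F 2 θ h v) (rr F θ h.toCore g₀ os) →
            letI : DecidableEq (Σ K, SiteSeqKey F (0 + K)) := Classical.decEq _
            ∃ δ : ℕ → ℝ, NE7.Core 1 (F.side ^ 4) (classSet₁₃ θ 0 g₀) (badClass₁₃ θ 0 g₀ (jc F θ h.toCore g₀ os))
              (gapCore2A₁₃ θ h.toCore 0 g₀ os (ρ F θ h.toCore g₀ os) (ρ' F θ h.toCore g₀ os) (n₁ F θ h.toCore g₀ os) (n₂ F θ h.toCore g₀ os))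
              (gapCore2B₁₃ θ h.toCore 0 g₀ os (ρ F θ h.toCore g₀ os) (ρ' F θ h.toCore g₀ os) (n₁ F θ h.toCore g₀ os) (n₂ F θ h.toCore g₀ os)) δ ∧ Summable δ)
    (htarget : ∀ (F : T4Family) (θ : Stage13HParams F 2) (hP : θ.Provisos₁₃CoPH F 2), ((θ.ZhUnity F 2 ∧ θ.SlotsNondegenerate₁₃ F 2) ∧ ¬ LiveSel F θ) → θ.Admissible F 2 →
      ∀ (g₀ : ℕ → ℝ) (os : List (ULoop F)), PHolderD4 β (datumOfRecord₁₃CoPH F 2 θ hP) (rr F θ hP g₀ os) →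
        ∃ δ : ℕ → ℝ, NE7.Target ((F.side : ℝ) ^ 4) 1 δ (fun K => T4GenFunBounds.schemeZ ((datumOfRecord₁₃CoPH F 2 θ hP).scheme g₀) os (0 + K))) :
    Summit.QuantumFields.YangMills.Theses.BalabanUVNodes.SpineGivenEndpointR13SepCoPHV := by
  obtain ⟨cr, hon, hoff⟩ := exists_reading_livePin (fun F θ hP g₀ os => crGap2₁₃V 2 (jc F θ hP g₀ os) ρ ρ' n₁ n₂ F θ hP g₀ os)
  exact spineGivenEndpointR13SepCoPHV_of_gap2Pin_signFree jc ρ ρ' n₁ n₂ hon hoff hζm β rr hρ hn (keyedRelWeight_of_gap2Pin_of_witness jc ρ ρ' n₁ n₂ hon hoff h20) hr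
    (keyedCoreEdgeHolderD4V_of_gap2Pin_of_witness_signFree jc ρ ρ' n₁ n₂ hon hoff hζm β rr hρ hn h19 htarget)

end Gap2RoadSF

/-! ## §3 Two closeness letters in, K3⁸ out -/

section Closeness

/-- ★★★ **K3⁸ ON THE PAIR ROAD FROM TWO CLOSENESS LETTERS.**  Displayed: (H-ζ) on the guarded admissible tuples of the live line; TWO relative closeness letters `δc` ((3.2) family,
units of `ε`) and `δc″` ((3.3) family, units of `2δ_k`) with `0 ≤ · ≤ 1∕16`, `Σ_K · < ∞` at every tuple (N16's two-run closeness; NOT PRINTED); K4; N20's WITNESS at the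
doubly-gapped carriers on the live line FOR EVERY local dial quadruple `(ρ, n₁; ρ′, n₂)` compatible with `(δc, δc″)` at the tuple; N19′'s WITNESS at the doubly-gapped cores
likewise (slot-keyed, under the prefix and `PHolderD4 β`); node U5's Target off the line.  Both dial pairs are minted inside the proof (this seat's
`exists_widthDepthLetters_of_summable`, twice) and handed to §2.  Every displayed binder a HYPOTHESIS inhabited for no family (K0⁷ OPEN); N21 NOT discharged by this; K3⁸ NOT
claimed. [bookkeeping] -/
theorem spineGivenEndpointR13SepCoPHV_of_gap2Road_of_closeness (β : ℝ) (rr : RateReadingFn) (jc : CutReading) (δc δc'' : WidthLetter₁₃CoPH 2)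
    (hζm : ∀ (F : T4Family) (θ : Stage13HParams F 2), θ.Provisos₁₃CoPH F 2 → ((θ.ZhUnity F 2 ∧ θ.SlotsNondegenerate₁₃ F 2) ∧ LiveSel F θ) → θ.Admissible F 2 →
      ZetaMeasurable F 2 θ.ζ)
    (h0 : ∀ (F : T4Family) (θ : Stage13HParams F 2) (hP : θ.Provisos₁₃CoPH F 2) (g₀ : ℕ → ℝ) (os : List (ULoop F)) (K : ℕ), 0 ≤ δc F θ hP g₀ os K)
    (h16 : ∀ (F : T4Family) (θ : Stage13HParams F 2) (hP : θ.Provisos₁₃CoPH F 2) (g₀ : ℕ → ℝ) (os : List (ULoop F)) (K : ℕ), δc F θ hP g₀ os K ≤ 1 / 16)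
    (hs : ∀ (F : T4Family) (θ : Stage13HParams F 2) (hP : θ.Provisos₁₃CoPH F 2) (g₀ : ℕ → ℝ) (os : List (ULoop F)), Summable (δc F θ hP g₀ os))
    (h0'' : ∀ (F : T4Family) (θ : Stage13HParams F 2) (hP : θ.Provisos₁₃CoPH F 2) (g₀ : ℕ → ℝ) (os : List (ULoop F)) (K : ℕ), 0 ≤ δc'' F θ hP g₀ os K)
    (h16'' : ∀ (F : T4Family) (θ : Stage13HParams F 2) (hP : θ.Provisos₁₃CoPH F 2) (g₀ : ℕ → ℝ) (os : List (ULoop F)) (K : ℕ), δc'' F θ hP g₀ os K ≤ 1 / 16)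
    (hs'' : ∀ (F : T4Family) (θ : Stage13HParams F 2) (hP : θ.Provisos₁₃CoPH F 2) (g₀ : ℕ → ℝ) (os : List (ULoop F)), Summable (δc'' F θ hP g₀ os))
    (hr : KeyedRatesHolderD4V β rr)
    (h20 : ∀ (F : T4Family) (θ : Stage13HParams F 2) (hP : θ.Provisos₁₃CoPH F 2), ((θ.ZhUnity F 2 ∧ θ.SlotsNondegenerate₁₃ F 2) ∧ LiveSel F θ) → θ.Admissible F 2 →
      ∀ (g₀ : ℕ → ℝ) (os : List (ULoop F)) (ρ : ℕ → ℝ) (n₁ : ℕ → ℕ) (ρ' : ℕ → ℝ) (n₂ : ℕ → ℕ),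
        (∀ K, 0 ≤ ρ K) ∧ (∀ K, ρ K ≤ 1) ∧ Summable (fun K => 1 / ((n₁ K : ℝ) + 1)) ∧ (∀ K, 2 * δc F θ hP g₀ os K ≤ ρ K) ∧
          (∀ K, (1 : ℝ) / 2 ≤ (1 - ρ K) ^ (n₁ K + 2)) ∧ (∀ K i, i ≤ n₁ K + 2 → δc F θ hP g₀ os K ≤ (1 - ρ K) ^ i * ρ K) →
        (∀ K, 0 ≤ ρ' K) ∧ (∀ K, ρ' K ≤ 1) ∧ Summable (fun K => 1 / ((n₂ K : ℝ) + 1)) ∧ (∀ K, 2 * δc'' F θ hP g₀ os K ≤ ρ' K) ∧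
          (∀ K, (1 : ℝ) / 2 ≤ (1 - ρ' K) ^ (n₂ K + 2)) ∧ (∀ K i, i ≤ n₂ K + 2 → δc'' F θ hP g₀ os K ≤ (1 - ρ' K) ^ i * ρ' K) →
        ∃ W : ℕ → ℝ, RelWeightBound 1 (classSet₁₃ θ 0 g₀) (gapWeight2A₁₃ θ hP 0 g₀ os ρ ρ' n₁ n₂) (gapWeight2B₁₃ θ hP 0 g₀ os ρ ρ' n₁ n₂)
          (badClass₁₃ θ 0 g₀ (jc F θ hP g₀ os)) W)
    (h19 : ∀ (F : T4Family) (θ : Stage13HParams F 2) (h : θ.Provisos₁₃SepCoPH F 2) (v : Revision₁₃ F 2 θ h),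
      ((θ.ZhUnity F 2 ∧ θ.SlotsNondegenerate₁₃ F 2) ∧ LiveSel F θ) → θ.Admissible F 2 →
      B16.EndStatementBPrinted (datumOfRecord₁₃SepCoPHV F 2 θ h v).C → DagBinding.EndpointExistence (datumOfRecord₁₃SepCoPHV F 2 θ h v).C.toB12 →
        ForSmallCouplings (datumOfRecord₁₃SepCoPHV F 2 θ h v) fun g₀ => ∀ (os : List (ULoop F)) (ρ : ℕ → ℝ) (n₁ : ℕ → ℕ) (ρ' : ℕ → ℝ) (n₂ : ℕ → ℕ),
          (∀ K, 0 ≤ ρ K) ∧ (∀ K, ρ K ≤ 1) ∧ Summable (fun K => 1 / ((n₁ K : ℝ) + 1)) ∧ (∀ K, 2 * δc F θ h.toCore g₀ os K ≤ ρ K) ∧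
            (∀ K, (1 : ℝ) / 2 ≤ (1 - ρ K) ^ (n₁ K + 2)) ∧ (∀ K i, i ≤ n₁ K + 2 → δc F θ h.toCore g₀ os K ≤ (1 - ρ K) ^ i * ρ K) →
          (∀ K, 0 ≤ ρ' K) ∧ (∀ K, ρ' K ≤ 1) ∧ Summable (fun K => 1 / ((n₂ K : ℝ) + 1)) ∧ (∀ K, 2 * δc'' F θ h.toCore g₀ os K ≤ ρ' K) ∧
            (∀ K, (1 : ℝ) / 2 ≤ (1 - ρ' K) ^ (n₂ K + 2)) ∧ (∀ K i, i ≤ n₂ K + 2 → δc'' F θ h.toCore g₀ os K ≤ (1 - ρ' K) ^ i * ρ' K) →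
          PHolderD4 β (datumOfRecord₁₃SepCoPHV F 2 θ h v) (rr F θ h.toCore g₀ os) →
            letI : DecidableEq (Σ K, SiteSeqKey F (0 + K)) := Classical.decEq _
            ∃ δ : ℕ → ℝ, NE7.Core 1 (F.side ^ 4) (classSet₁₃ θ 0 g₀) (badClass₁₃ θ 0 g₀ (jc F θ h.toCore g₀ os))
              (gapCore2A₁₃ θ h.toCore 0 g₀ os ρ ρ' n₁ n₂) (gapCore2B₁₃ θ h.toCore 0 g₀ os ρ ρ' n₁ n₂) δ ∧ Summable δ)
    (htarget : ∀ (F : T4Family) (θ : Stage13HParams F 2) (hP : θ.Provisos₁₃CoPH F 2), ((θ.ZhUnity F 2 ∧ θ.SlotsNondegenerate₁₃ F 2) ∧ ¬ LiveSel F θ) → θ.Admissible F 2 →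
      ∀ (g₀ : ℕ → ℝ) (os : List (ULoop F)), PHolderD4 β (datumOfRecord₁₃CoPH F 2 θ hP) (rr F θ hP g₀ os) →
        ∃ δ : ℕ → ℝ, NE7.Target ((F.side : ℝ) ^ 4) 1 δ (fun K => T4GenFunBounds.schemeZ ((datumOfRecord₁₃CoPH F 2 θ hP).scheme g₀) os (0 + K))) :
    Summit.QuantumFields.YangMills.Theses.BalabanUVNodes.SpineGivenEndpointR13SepCoPHV := by
  obtain ⟨ρ, n₁, hc⟩ := exists_widthDepthLetters_of_summable (N := 2) δc h0 h16 hs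
  obtain ⟨ρ', n₂, hc''⟩ := exists_widthDepthLetters_of_summable (N := 2) δc'' h0'' h16'' hs''
  refine spineGivenEndpointR13SepCoPHV_of_gap2Road_signFree β rr jc ρ ρ' n₁ n₂ hζm
    (fun F θ hP g₀ os K => ⟨⟨(hc F θ hP g₀ os).1 K, (hc F θ hP g₀ os).2.1 K⟩, ⟨(hc'' F θ hP g₀ os).1 K, (hc'' F θ hP g₀ os).2.1 K⟩⟩)
    (fun F θ hP g₀ os => (hc F θ hP g₀ os).2.2.1.add (hc'' F θ hP g₀ os).2.2.1) hr
    (fun F θ hP hG hθ g₀ os => h20 F θ hP hG hθ g₀ os _ _ _ _ (hc F θ hP g₀ os) (hc'' F θ hP g₀ os)) (fun F θ h v hG hθ hB hE => ?_) htarget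
  exact ForSmallCouplings.mono (fun g₀ h' os hPr => h' os _ _ _ _ (hc F θ h.toCore g₀ os) (hc'' F θ h.toCore g₀ os) hPr) (h19 F θ h v hG hθ hB hE)

/-- ★★★ **K3⁸ ON THE PAIR ROAD FROM TWO CLOSENESS LETTERS — N20 READ AT THE RECORD.**  As `spineGivenEndpointR13SepCoPHV_of_gap2Road_of_closeness`, but N20's witness is asked
DIAL-FREE at dag-n20-d's record weights `weightA₁₃ ∕ weightB₁₃` on the live line and transferred to the doubly-gapped carriers by dag-n21-d V5b's
`relWeightBound_gap2Carriers_iff_record` (+ the cut reading's persistence-policy row `jc … K < K ∨ jc … K = 0`). [bookkeeping] -/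
theorem spineGivenEndpointR13SepCoPHV_of_gap2Road_of_closeness_record (β : ℝ) (rr : RateReadingFn) (jc : CutReading) (δc δc'' : WidthLetter₁₃CoPH 2)
    (hζm : ∀ (F : T4Family) (θ : Stage13HParams F 2), θ.Provisos₁₃CoPH F 2 → ((θ.ZhUnity F 2 ∧ θ.SlotsNondegenerate₁₃ F 2) ∧ LiveSel F θ) → θ.Admissible F 2 →
      ZetaMeasurable F 2 θ.ζ)
    (h0 : ∀ (F : T4Family) (θ : Stage13HParams F 2) (hP : θ.Provisos₁₃CoPH F 2) (g₀ : ℕ → ℝ) (os : List (ULoop F)) (K : ℕ), 0 ≤ δc F θ hP g₀ os K)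
    (h16 : ∀ (F : T4Family) (θ : Stage13HParams F 2) (hP : θ.Provisos₁₃CoPH F 2) (g₀ : ℕ → ℝ) (os : List (ULoop F)) (K : ℕ), δc F θ hP g₀ os K ≤ 1 / 16)
    (hs : ∀ (F : T4Family) (θ : Stage13HParams F 2) (hP : θ.Provisos₁₃CoPH F 2) (g₀ : ℕ → ℝ) (os : List (ULoop F)), Summable (δc F θ hP g₀ os))
    (h0'' : ∀ (F : T4Family) (θ : Stage13HParams F 2) (hP : θ.Provisos₁₃CoPH F 2) (g₀ : ℕ → ℝ) (os : List (ULoop F)) (K : ℕ), 0 ≤ δc'' F θ hP g₀ os K)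
    (h16'' : ∀ (F : T4Family) (θ : Stage13HParams F 2) (hP : θ.Provisos₁₃CoPH F 2) (g₀ : ℕ → ℝ) (os : List (ULoop F)) (K : ℕ), δc'' F θ hP g₀ os K ≤ 1 / 16)
    (hs'' : ∀ (F : T4Family) (θ : Stage13HParams F 2) (hP : θ.Provisos₁₃CoPH F 2) (g₀ : ℕ → ℝ) (os : List (ULoop F)), Summable (δc'' F θ hP g₀ os))
    (hj : ∀ (F : T4Family) (θ : Stage13HParams F 2) (hP : θ.Provisos₁₃CoPH F 2) (g₀ : ℕ → ℝ) (os : List (ULoop F)) (K : ℕ),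
      jc F θ hP g₀ os K < 0 + K ∨ jc F θ hP g₀ os K = 0)
    (hr : KeyedRatesHolderD4V β rr)
    (h20 : ∀ (F : T4Family) (θ : Stage13HParams F 2) (hP : θ.Provisos₁₃CoPH F 2), ((θ.ZhUnity F 2 ∧ θ.SlotsNondegenerate₁₃ F 2) ∧ LiveSel F θ) → θ.Admissible F 2 →
      ∀ (g₀ : ℕ → ℝ) (os : List (ULoop F)),
        ∃ W : ℕ → ℝ, RelWeightBound 1 (classSet₁₃ θ 0 g₀) (weightA₁₃ θ hP 0 g₀ os) (weightB₁₃ θ hP 0 g₀ os) (badClass₁₃ θ 0 g₀ (jc F θ hP g₀ os)) W)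
    (h19 : ∀ (F : T4Family) (θ : Stage13HParams F 2) (h : θ.Provisos₁₃SepCoPH F 2) (v : Revision₁₃ F 2 θ h),
      ((θ.ZhUnity F 2 ∧ θ.SlotsNondegenerate₁₃ F 2) ∧ LiveSel F θ) → θ.Admissible F 2 →
      B16.EndStatementBPrinted (datumOfRecord₁₃SepCoPHV F 2 θ h v).C → DagBinding.EndpointExistence (datumOfRecord₁₃SepCoPHV F 2 θ h v).C.toB12 →
        ForSmallCouplings (datumOfRecord₁₃SepCoPHV F 2 θ h v) fun g₀ => ∀ (os : List (ULoop F)) (ρ : ℕ → ℝ) (n₁ : ℕ → ℕ) (ρ' : ℕ → ℝ) (n₂ : ℕ → ℕ),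
          (∀ K, 0 ≤ ρ K) ∧ (∀ K, ρ K ≤ 1) ∧ Summable (fun K => 1 / ((n₁ K : ℝ) + 1)) ∧ (∀ K, 2 * δc F θ h.toCore g₀ os K ≤ ρ K) ∧
            (∀ K, (1 : ℝ) / 2 ≤ (1 - ρ K) ^ (n₁ K + 2)) ∧ (∀ K i, i ≤ n₁ K + 2 → δc F θ h.toCore g₀ os K ≤ (1 - ρ K) ^ i * ρ K) →
          (∀ K, 0 ≤ ρ' K) ∧ (∀ K, ρ' K ≤ 1) ∧ Summable (fun K => 1 / ((n₂ K : ℝ) + 1)) ∧ (∀ K, 2 * δc'' F θ h.toCore g₀ os K ≤ ρ' K) ∧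
            (∀ K, (1 : ℝ) / 2 ≤ (1 - ρ' K) ^ (n₂ K + 2)) ∧ (∀ K i, i ≤ n₂ K + 2 → δc'' F θ h.toCore g₀ os K ≤ (1 - ρ' K) ^ i * ρ' K) →
          PHolderD4 β (datumOfRecord₁₃SepCoPHV F 2 θ h v) (rr F θ h.toCore g₀ os) →
            letI : DecidableEq (Σ K, SiteSeqKey F (0 + K)) := Classical.decEq _
            ∃ δ : ℕ → ℝ, NE7.Core 1 (F.side ^ 4) (classSet₁₃ θ 0 g₀) (badClass₁₃ θ 0 g₀ (jc F θ h.toCore g₀ os))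
              (gapCore2A₁₃ θ h.toCore 0 g₀ os ρ ρ' n₁ n₂) (gapCore2B₁₃ θ h.toCore 0 g₀ os ρ ρ' n₁ n₂) δ ∧ Summable δ)
    (htarget : ∀ (F : T4Family) (θ : Stage13HParams F 2) (hP : θ.Provisos₁₃CoPH F 2), ((θ.ZhUnity F 2 ∧ θ.SlotsNondegenerate₁₃ F 2) ∧ ¬ LiveSel F θ) → θ.Admissible F 2 →
      ∀ (g₀ : ℕ → ℝ) (os : List (ULoop F)), PHolderD4 β (datumOfRecord₁₃CoPH F 2 θ hP) (rr F θ hP g₀ os) →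
        ∃ δ : ℕ → ℝ, NE7.Target ((F.side : ℝ) ^ 4) 1 δ (fun K => T4GenFunBounds.schemeZ ((datumOfRecord₁₃CoPH F 2 θ hP).scheme g₀) os (0 + K))) :
    Summit.QuantumFields.YangMills.Theses.BalabanUVNodes.SpineGivenEndpointR13SepCoPHV := by
  refine spineGivenEndpointR13SepCoPHV_of_gap2Road_of_closeness β rr jc δc δc'' hζm h0 h16 hs h0'' h16'' hs'' hr
    (fun F θ hP hG hθ g₀ os ρ n₁ ρ' n₂ _ _ => ?_) h19 htarget
  obtain ⟨W, hW⟩ := h20 F θ hP hG hθ g₀ os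
  exact ⟨W, (relWeightBound_gap2Carriers_iff_record 0 θ hP g₀ os (EOfRecord₁₃ F 2 θ.toStage13Params) hG.2 (hζm F θ hP hG hθ) (jc F θ hP g₀ os)
    (hj F θ hP g₀ os) ρ ρ' n₁ n₂ W).2 hW⟩

/-- ★★ **A PAIR-PINNED READING WITH ALL FOUR K5 FACES, FROM TWO CLOSENESS LETTERS** — there are letters `(ρ, n₁)` compatible with `δc` and `(ρ′, n₂)` compatible with `δc″` at
every tuple, and a reading pinned to `crGap2₁₃V 2 (jc …) ρ ρ′ n₁ n₂` on the live line ∕ `crOneTerm₁₃ 0` off it carrying `KeyedRelWeight ∧ KeyedShellWeight ∧ KeyedExtractionV ∧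
KeyedCoreEdgeHolderD4V β · rr` — N21's and N27x's by THEOREM (dag-n21-w7's sign-free face ∕ V3's extraction).  The registered pin is the plan's, untouched. [bookkeeping] -/
theorem exists_gap2Pinned_faces_of_closeness (β : ℝ) (rr : RateReadingFn) (jc : CutReading) (δc δc'' : WidthLetter₁₃CoPH 2)
    (hζm : ∀ (F : T4Family) (θ : Stage13HParams F 2), θ.Provisos₁₃CoPH F 2 → ((θ.ZhUnity F 2 ∧ θ.SlotsNondegenerate₁₃ F 2) ∧ LiveSel F θ) → θ.Admissible F 2 →
      ZetaMeasurable F 2 θ.ζ)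
    (h0 : ∀ (F : T4Family) (θ : Stage13HParams F 2) (hP : θ.Provisos₁₃CoPH F 2) (g₀ : ℕ → ℝ) (os : List (ULoop F)) (K : ℕ), 0 ≤ δc F θ hP g₀ os K)
    (h16 : ∀ (F : T4Family) (θ : Stage13HParams F 2) (hP : θ.Provisos₁₃CoPH F 2) (g₀ : ℕ → ℝ) (os : List (ULoop F)) (K : ℕ), δc F θ hP g₀ os K ≤ 1 / 16)
    (hs : ∀ (F : T4Family) (θ : Stage13HParams F 2) (hP : θ.Provisos₁₃CoPH F 2) (g₀ : ℕ → ℝ) (os : List (ULoop F)), Summable (δc F θ hP g₀ os))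
    (h0'' : ∀ (F : T4Family) (θ : Stage13HParams F 2) (hP : θ.Provisos₁₃CoPH F 2) (g₀ : ℕ → ℝ) (os : List (ULoop F)) (K : ℕ), 0 ≤ δc'' F θ hP g₀ os K)
    (h16'' : ∀ (F : T4Family) (θ : Stage13HParams F 2) (hP : θ.Provisos₁₃CoPH F 2) (g₀ : ℕ → ℝ) (os : List (ULoop F)) (K : ℕ), δc'' F θ hP g₀ os K ≤ 1 / 16)
    (hs'' : ∀ (F : T4Family) (θ : Stage13HParams F 2) (hP : θ.Provisos₁₃CoPH F 2) (g₀ : ℕ → ℝ) (os : List (ULoop F)), Summable (δc'' F θ hP g₀ os))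
    (h20 : ∀ (F : T4Family) (θ : Stage13HParams F 2) (hP : θ.Provisos₁₃CoPH F 2), ((θ.ZhUnity F 2 ∧ θ.SlotsNondegenerate₁₃ F 2) ∧ LiveSel F θ) → θ.Admissible F 2 →
      ∀ (g₀ : ℕ → ℝ) (os : List (ULoop F)) (ρ : ℕ → ℝ) (n₁ : ℕ → ℕ) (ρ' : ℕ → ℝ) (n₂ : ℕ → ℕ),
        (∀ K, 0 ≤ ρ K) ∧ (∀ K, ρ K ≤ 1) ∧ Summable (fun K => 1 / ((n₁ K : ℝ) + 1)) ∧ (∀ K, 2 * δc F θ hP g₀ os K ≤ ρ K) ∧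
          (∀ K, (1 : ℝ) / 2 ≤ (1 - ρ K) ^ (n₁ K + 2)) ∧ (∀ K i, i ≤ n₁ K + 2 → δc F θ hP g₀ os K ≤ (1 - ρ K) ^ i * ρ K) →
        (∀ K, 0 ≤ ρ' K) ∧ (∀ K, ρ' K ≤ 1) ∧ Summable (fun K => 1 / ((n₂ K : ℝ) + 1)) ∧ (∀ K, 2 * δc'' F θ hP g₀ os K ≤ ρ' K) ∧
          (∀ K, (1 : ℝ) / 2 ≤ (1 - ρ' K) ^ (n₂ K + 2)) ∧ (∀ K i, i ≤ n₂ K + 2 → δc'' F θ hP g₀ os K ≤ (1 - ρ' K) ^ i * ρ' K) →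
        ∃ W : ℕ → ℝ, RelWeightBound 1 (classSet₁₃ θ 0 g₀) (gapWeight2A₁₃ θ hP 0 g₀ os ρ ρ' n₁ n₂) (gapWeight2B₁₃ θ hP 0 g₀ os ρ ρ' n₁ n₂)
          (badClass₁₃ θ 0 g₀ (jc F θ hP g₀ os)) W)
    (h19 : ∀ (F : T4Family) (θ : Stage13HParams F 2) (h : θ.Provisos₁₃SepCoPH F 2) (v : Revision₁₃ F 2 θ h),
      ((θ.ZhUnity F 2 ∧ θ.SlotsNondegenerate₁₃ F 2) ∧ LiveSel F θ) → θ.Admissible F 2 →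
      B16.EndStatementBPrinted (datumOfRecord₁₃SepCoPHV F 2 θ h v).C → DagBinding.EndpointExistence (datumOfRecord₁₃SepCoPHV F 2 θ h v).C.toB12 →
        ForSmallCouplings (datumOfRecord₁₃SepCoPHV F 2 θ h v) fun g₀ => ∀ (os : List (ULoop F)) (ρ : ℕ → ℝ) (n₁ : ℕ → ℕ) (ρ' : ℕ → ℝ) (n₂ : ℕ → ℕ),
          (∀ K, 0 ≤ ρ K) ∧ (∀ K, ρ K ≤ 1) ∧ Summable (fun K => 1 / ((n₁ K : ℝ) + 1)) ∧ (∀ K, 2 * δc F θ h.toCore g₀ os K ≤ ρ K) ∧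
            (∀ K, (1 : ℝ) / 2 ≤ (1 - ρ K) ^ (n₁ K + 2)) ∧ (∀ K i, i ≤ n₁ K + 2 → δc F θ h.toCore g₀ os K ≤ (1 - ρ K) ^ i * ρ K) →
          (∀ K, 0 ≤ ρ' K) ∧ (∀ K, ρ' K ≤ 1) ∧ Summable (fun K => 1 / ((n₂ K : ℝ) + 1)) ∧ (∀ K, 2 * δc'' F θ h.toCore g₀ os K ≤ ρ' K) ∧
            (∀ K, (1 : ℝ) / 2 ≤ (1 - ρ' K) ^ (n₂ K + 2)) ∧ (∀ K i, i ≤ n₂ K + 2 → δc'' F θ h.toCore g₀ os K ≤ (1 - ρ' K) ^ i * ρ' K) →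
          PHolderD4 β (datumOfRecord₁₃SepCoPHV F 2 θ h v) (rr F θ h.toCore g₀ os) →
            letI : DecidableEq (Σ K, SiteSeqKey F (0 + K)) := Classical.decEq _
            ∃ δ : ℕ → ℝ, NE7.Core 1 (F.side ^ 4) (classSet₁₃ θ 0 g₀) (badClass₁₃ θ 0 g₀ (jc F θ h.toCore g₀ os))
              (gapCore2A₁₃ θ h.toCore 0 g₀ os ρ ρ' n₁ n₂) (gapCore2B₁₃ θ h.toCore 0 g₀ os ρ ρ' n₁ n₂) δ ∧ Summable δ)
    (htarget : ∀ (F : T4Family) (θ : Stage13HParams F 2) (hP : θ.Provisos₁₃CoPH F 2), ((θ.ZhUnity F 2 ∧ θ.SlotsNondegenerate₁₃ F 2) ∧ ¬ LiveSel F θ) → θ.Admissible F 2 →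
      ∀ (g₀ : ℕ → ℝ) (os : List (ULoop F)), PHolderD4 β (datumOfRecord₁₃CoPH F 2 θ hP) (rr F θ hP g₀ os) →
        ∃ δ : ℕ → ℝ, NE7.Target ((F.side : ℝ) ^ 4) 1 δ (fun K => T4GenFunBounds.schemeZ ((datumOfRecord₁₃CoPH F 2 θ hP).scheme g₀) os (0 + K))) :
    ∃ (ρ : WidthLetter₁₃CoPH 2) (n₁ : DepthLetter₁₃CoPH 2) (ρ' : WidthLetter₁₃CoPH 2) (n₂ : DepthLetter₁₃CoPH 2) (cr : SpineReading),
      (∀ (F : T4Family) (θ : Stage13HParams F 2) (hP : θ.Provisos₁₃CoPH F 2) (g₀ : ℕ → ℝ) (os : List (ULoop F)),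
        (∀ K, 0 ≤ ρ F θ hP g₀ os K) ∧ (∀ K, ρ F θ hP g₀ os K ≤ 1) ∧ Summable (fun K => 1 / ((n₁ F θ hP g₀ os K : ℝ) + 1)) ∧
        (∀ K, 2 * δc F θ hP g₀ os K ≤ ρ F θ hP g₀ os K) ∧ (∀ K, (1 : ℝ) / 2 ≤ (1 - ρ F θ hP g₀ os K) ^ (n₁ F θ hP g₀ os K + 2)) ∧
        (∀ K i, i ≤ n₁ F θ hP g₀ os K + 2 → δc F θ hP g₀ os K ≤ (1 - ρ F θ hP g₀ os K) ^ i * ρ F θ hP g₀ os K)) ∧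
      (∀ (F : T4Family) (θ : Stage13HParams F 2) (hP : θ.Provisos₁₃CoPH F 2) (g₀ : ℕ → ℝ) (os : List (ULoop F)),
        (∀ K, 0 ≤ ρ' F θ hP g₀ os K) ∧ (∀ K, ρ' F θ hP g₀ os K ≤ 1) ∧ Summable (fun K => 1 / ((n₂ F θ hP g₀ os K : ℝ) + 1)) ∧
        (∀ K, 2 * δc'' F θ hP g₀ os K ≤ ρ' F θ hP g₀ os K) ∧ (∀ K, (1 : ℝ) / 2 ≤ (1 - ρ' F θ hP g₀ os K) ^ (n₂ F θ hP g₀ os K + 2)) ∧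
        (∀ K i, i ≤ n₂ F θ hP g₀ os K + 2 → δc'' F θ hP g₀ os K ≤ (1 - ρ' F θ hP g₀ os K) ^ i * ρ' F θ hP g₀ os K)) ∧
      (∀ (F : T4Family) (θ : Stage13HParams F 2) (hP : θ.Provisos₁₃CoPH F 2) (g₀ : ℕ → ℝ) (os : List (ULoop F)),
        LiveSel F θ → cr F θ hP g₀ os = crGap2₁₃V 2 (jc F θ hP g₀ os) ρ ρ' n₁ n₂ F θ hP g₀ os) ∧
      (∀ (F : T4Family) (θ : Stage13HParams F 2) (hP : θ.Provisos₁₃CoPH F 2) (g₀ : ℕ → ℝ) (os : List (ULoop F)),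
        ¬ LiveSel F θ → cr F θ hP g₀ os = crOneTerm₁₃ 0 F θ hP g₀ os) ∧
      KeyedRelWeight cr ∧ KeyedShellWeight cr ∧ KeyedExtractionV cr ∧ KeyedCoreEdgeHolderD4V β cr rr := by
  obtain ⟨ρ, n₁, hc⟩ := exists_widthDepthLetters_of_summable (N := 2) δc h0 h16 hs
  obtain ⟨ρ', n₂, hc''⟩ := exists_widthDepthLetters_of_summable (N := 2) δc'' h0'' h16'' hs''
  have hρ : ∀ (F : T4Family) (θ : Stage13HParams F 2) (hP : θ.Provisos₁₃CoPH F 2) (g₀ : ℕ → ℝ) (os : List (ULoop F)) (K : ℕ),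
      (0 ≤ ρ F θ hP g₀ os K ∧ ρ F θ hP g₀ os K ≤ 1) ∧ (0 ≤ ρ' F θ hP g₀ os K ∧ ρ' F θ hP g₀ os K ≤ 1) :=
    fun F θ hP g₀ os K => ⟨⟨(hc F θ hP g₀ os).1 K, (hc F θ hP g₀ os).2.1 K⟩, ⟨(hc'' F θ hP g₀ os).1 K, (hc'' F θ hP g₀ os).2.1 K⟩⟩
  have hn : ∀ (F : T4Family) (θ : Stage13HParams F 2) (hP : θ.Provisos₁₃CoPH F 2) (g₀ : ℕ → ℝ) (os : List (ULoop F)),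
      Summable (fun K => 1 / ((n₁ F θ hP g₀ os K : ℝ) + 1) + 1 / ((n₂ F θ hP g₀ os K : ℝ) + 1)) :=
    fun F θ hP g₀ os => (hc F θ hP g₀ os).2.2.1.add (hc'' F θ hP g₀ os).2.2.1
  obtain ⟨cr, hon, hoff⟩ := exists_reading_livePin (fun F θ hP g₀ os => crGap2₁₃V 2 (jc F θ hP g₀ os) ρ ρ' n₁ n₂ F θ hP g₀ os)
  refine ⟨ρ, n₁, ρ', n₂, cr, hc, hc'', hon, hoff,
    keyedRelWeight_of_gap2Pin_of_witness jc ρ ρ' n₁ n₂ hon hoff (fun F θ hP hG hθ g₀ os => h20 F θ hP hG hθ g₀ os _ _ _ _ (hc F θ hP g₀ os) (hc'' F θ hP g₀ os)),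
    keyedShellWeight_of_gap2Pin_signFree jc ρ ρ' n₁ n₂ hon hoff hζm hρ hn, (keyedExtraction_of_gap2Pin jc ρ ρ' n₁ n₂ hon hoff hζm).2,
    keyedCoreEdgeHolderD4V_of_gap2Pin_of_witness_signFree jc ρ ρ' n₁ n₂ hon hoff hζm β rr hρ hn (fun F θ h v hG hθ hB hE => ?_) htarget⟩
  exact ForSmallCouplings.mono (fun g₀ h' os hPr => h' os _ _ _ _ (hc F θ h.toCore g₀ os) (hc'' F θ h.toCore g₀ os) hPr) (h19 F θ h v hG hθ hB hE)

end Closeness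

/-! ## §4 Two closeness letters at the ZERO CUT: the pair road's fewest-binder edition (sign-free) -/

section ClosenessCutZero

/-- ★★★ **K3⁸ ON THE PAIR ROAD FROM TWO CLOSENESS LETTERS AT THE ZERO CUT `jc ≡ 0` — NO N20 LINE, NO SIGN ROWS.**  §3's `…_of_gap2Road_of_closeness` at the zero cut
reading: N20's witness is dag-n20-w2's any-carriers theorem `relWeightBound_classSet₁₃_cutZero` (`W := 0`, the bad class is empty), and N19′'s NE7 core on the (empty-cut) bad
class follows from the all-classes sandwich (`core_badClass₁₃_cutZero_of_allClasses`).  Displayed: (H-ζ) on the live line; both closeness letters' rows; K4; N19′ = the NE7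
sandwich `e^{c−L⁴δ_K}·coreA ≤ coreB ≤ e^{c+L⁴δ_K}·coreA` on EVERY keyed class between the two runs' DOUBLY-GAPPED cores, `Σ δ < ∞`, FOR EVERY local dial quadruple compatible
with `(δc, δc″)` (slot-keyed, under the prefix and `PHolderD4 β`) — NE7 proper, NOT PRINTED for `d = 4`; node U5's Target off the live line.  K3⁸ NOT claimed. [bookkeeping] -/
theorem spineGivenEndpointR13SepCoPHV_of_gap2Road_of_closeness_cutZero (β : ℝ) (rr : RateReadingFn) (δc δc'' : WidthLetter₁₃CoPH 2)
    (hζm : ∀ (F : T4Family) (θ : Stage13HParams F 2), θ.Provisos₁₃CoPH F 2 → ((θ.ZhUnity F 2 ∧ θ.SlotsNondegenerate₁₃ F 2) ∧ LiveSel F θ) → θ.Admissible F 2 →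
      ZetaMeasurable F 2 θ.ζ)
    (h0 : ∀ (F : T4Family) (θ : Stage13HParams F 2) (hP : θ.Provisos₁₃CoPH F 2) (g₀ : ℕ → ℝ) (os : List (ULoop F)) (K : ℕ), 0 ≤ δc F θ hP g₀ os K)
    (h16 : ∀ (F : T4Family) (θ : Stage13HParams F 2) (hP : θ.Provisos₁₃CoPH F 2) (g₀ : ℕ → ℝ) (os : List (ULoop F)) (K : ℕ), δc F θ hP g₀ os K ≤ 1 / 16)
    (hs : ∀ (F : T4Family) (θ : Stage13HParams F 2) (hP : θ.Provisos₁₃CoPH F 2) (g₀ : ℕ → ℝ) (os : List (ULoop F)), Summable (δc F θ hP g₀ os))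
    (h0'' : ∀ (F : T4Family) (θ : Stage13HParams F 2) (hP : θ.Provisos₁₃CoPH F 2) (g₀ : ℕ → ℝ) (os : List (ULoop F)) (K : ℕ), 0 ≤ δc'' F θ hP g₀ os K)
    (h16'' : ∀ (F : T4Family) (θ : Stage13HParams F 2) (hP : θ.Provisos₁₃CoPH F 2) (g₀ : ℕ → ℝ) (os : List (ULoop F)) (K : ℕ), δc'' F θ hP g₀ os K ≤ 1 / 16)
    (hs'' : ∀ (F : T4Family) (θ : Stage13HParams F 2) (hP : θ.Provisos₁₃CoPH F 2) (g₀ : ℕ → ℝ) (os : List (ULoop F)), Summable (δc'' F θ hP g₀ os))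
    (hr : KeyedRatesHolderD4V β rr)
    (h19 : ∀ (F : T4Family) (θ : Stage13HParams F 2) (h : θ.Provisos₁₃SepCoPH F 2) (v : Revision₁₃ F 2 θ h),
      ((θ.ZhUnity F 2 ∧ θ.SlotsNondegenerate₁₃ F 2) ∧ LiveSel F θ) → θ.Admissible F 2 →
      B16.EndStatementBPrinted (datumOfRecord₁₃SepCoPHV F 2 θ h v).C → DagBinding.EndpointExistence (datumOfRecord₁₃SepCoPHV F 2 θ h v).C.toB12 →
        ForSmallCouplings (datumOfRecord₁₃SepCoPHV F 2 θ h v) fun g₀ => ∀ (os : List (ULoop F)) (ρ : ℕ → ℝ) (n₁ : ℕ → ℕ) (ρ' : ℕ → ℝ) (n₂ : ℕ → ℕ),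
          (∀ K, 0 ≤ ρ K) ∧ (∀ K, ρ K ≤ 1) ∧ Summable (fun K => 1 / ((n₁ K : ℝ) + 1)) ∧ (∀ K, 2 * δc F θ h.toCore g₀ os K ≤ ρ K) ∧
            (∀ K, (1 : ℝ) / 2 ≤ (1 - ρ K) ^ (n₁ K + 2)) ∧ (∀ K i, i ≤ n₁ K + 2 → δc F θ h.toCore g₀ os K ≤ (1 - ρ K) ^ i * ρ K) →
          (∀ K, 0 ≤ ρ' K) ∧ (∀ K, ρ' K ≤ 1) ∧ Summable (fun K => 1 / ((n₂ K : ℝ) + 1)) ∧ (∀ K, 2 * δc'' F θ h.toCore g₀ os K ≤ ρ' K) ∧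
            (∀ K, (1 : ℝ) / 2 ≤ (1 - ρ' K) ^ (n₂ K + 2)) ∧ (∀ K i, i ≤ n₂ K + 2 → δc'' F θ h.toCore g₀ os K ≤ (1 - ρ' K) ^ i * ρ' K) →
          PHolderD4 β (datumOfRecord₁₃SepCoPHV F 2 θ h v) (rr F θ h.toCore g₀ os) →
            ∃ δ : ℕ → ℝ, (∀ K : ℕ, ∃ c : ℝ, ∀ t : ℝ, |t| ≤ 1 → ∀ x ∈ classSet₁₃ θ 0 g₀ K,
              Real.exp (c - F.side ^ 4 * δ K) * gapCore2A₁₃ θ h.toCore 0 g₀ os ρ ρ' n₁ n₂ K t x ≤ gapCore2B₁₃ θ h.toCore 0 g₀ os ρ ρ' n₁ n₂ K t x ∧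
                gapCore2B₁₃ θ h.toCore 0 g₀ os ρ ρ' n₁ n₂ K t x ≤ Real.exp (c + F.side ^ 4 * δ K) * gapCore2A₁₃ θ h.toCore 0 g₀ os ρ ρ' n₁ n₂ K t x) ∧ Summable δ)
    (htarget : ∀ (F : T4Family) (θ : Stage13HParams F 2) (hP : θ.Provisos₁₃CoPH F 2), ((θ.ZhUnity F 2 ∧ θ.SlotsNondegenerate₁₃ F 2) ∧ ¬ LiveSel F θ) → θ.Admissible F 2 →
      ∀ (g₀ : ℕ → ℝ) (os : List (ULoop F)), PHolderD4 β (datumOfRecord₁₃CoPH F 2 θ hP) (rr F θ hP g₀ os) →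
        ∃ δ : ℕ → ℝ, NE7.Target ((F.side : ℝ) ^ 4) 1 δ (fun K => T4GenFunBounds.schemeZ ((datumOfRecord₁₃CoPH F 2 θ hP).scheme g₀) os (0 + K))) :
    Summit.QuantumFields.YangMills.Theses.BalabanUVNodes.SpineGivenEndpointR13SepCoPHV := by
  refine spineGivenEndpointR13SepCoPHV_of_gap2Road_of_closeness β rr (fun _ _ _ _ _ _ => 0) δc δc'' hζm h0 h16 hs h0'' h16'' hs'' hr
    (fun F θ hP _ _ g₀ os ρ n₁ ρ' n₂ _ _ => ⟨fun _ => 0, relWeightBound_classSet₁₃_cutZero θ 0 g₀ 1 _ _⟩) (fun F θ h v hG hθ hB hE => ?_) htarget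
  refine ForSmallCouplings.mono (fun g₀ h' os ρ n₁ ρ' n₂ hc hc'' hPr => ?_) (h19 F θ h v hG hθ hB hE)
  obtain ⟨δ, hδ, hsum⟩ := h' os ρ n₁ ρ' n₂ hc hc'' hPr
  letI : DecidableEq (Σ K, SiteSeqKey F (0 + K)) := Classical.decEq _
  exact ⟨δ, core_badClass₁₃_cutZero_of_allClasses θ g₀ hδ, hsum⟩

end ClosenessCutZero

end Summit.QuantumFields.YangMills.Theorems.N21GappedPairRoadK3V6KnitOfCloseness

end
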